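import Summits.BirchSwinnertonDyer.BirchSwinnertonDyer.Theorems.GenusKolyvaginAtTwoMultiGenusPrimitivityAtTwoDepthLaw

/-!
# Route `GenusKolyvaginAtTwo`, crux stmt-BirchSwinnertonDyer-24947 `MultiGenusPrimitivityAtTwo` (U): the REDUCED GENUS HEEGNER
# POINT `W_n = Y_n / 2^r` — existence, uniqueness, isotypy, and the certificate as its `2`-primitivity

Lead prover seat bsd-line-gk2-p1 (g5); sequel to `…DepthLaw` (p607907). Frame as there. By the depth law the top genus-character
component `Y_n = Σ_{g} χ_n(g)·g·y(n)` of a Kolyvagin–Heegner datum of square-free Kolyvagin conductor `n` (`r` primes) is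
`2^r`-divisible in `E(K[n])`; since `E(K[n])` has no `2`-torsion on the crux's frame (`ρ̄_{E,2}` onto, odd `d_K ≠ −3`), the root is
UNIQUE — the reduced genus Heegner point `W_n` — and `χ_n`-ISOTYPIC (`h·W_n = χ_n(h)·W_n`, i.e. a point of the `χ_n`-lattice
`E(K(√n*))^− ≅ E^{(n*)}(K)` up to the twist isomorphism). At a depth-2 level (`4 ∣ a_ℓ` for all `ℓ ∣ n`) the crux's certificate is
EXACTLY «`W_n ∉ 2E(K[n])`» (`heegner_certificate_iff_reducedGenusPoint_of_depth_two`). This is the object whose `2`-primitivity the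
BSD-side ledger (U-LEDGER (♣)) equates with the 2-Selmer-minimality of the genus pair `(E^{(n*)}, E^{(n*d_K)})` on `DEF = 1` cells —
W. Zhang's theorem at `p = 2` for that pair. Helper (`--supports stmt-BirchSwinnertonDyer-24947`); BSD is not proved by any of this.
-/

set_option linter.dupNamespace false -- tree convention: `Summit.BirchSwinnertonDyer.BirchSwinnertonDyer.Theorems` (summit = sub-problem)

noncomputable section

open scoped Classical

namespace Summit.BirchSwinnertonDyer.BirchSwinnertonDyer.Theorems.GenusKoly

open Finset NumberField WeierstrassCurve Literature.NumberTheory.EllipticCurves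
  Literature.NumberTheory.EllipticCurves.ModularForms

section Heegner

variable {W : WeierstrassCurve ℚ} [NeZero (W.conductorNorm ℤ)] {K : Type} [Field K] [NumberField K]
  {Dt : ModularParametrizationData W (W.conductorNorm ℤ)} {β : ℤ} {ι : K →+* ℂ}

/-- **The reduced genus Heegner point exists, is unique, and is `χ_n`-isotypic.** On the crux's frame (`W` globally minimal with
`ρ̄_{E,2}` onto, `K` imaginary quadratic with odd `d_K ≠ −3`, Heegner hypothesis), for `n` square-free of Kolyvagin primes at `2`,
a datum `d`, radicals `θ` and an enumeration `G` of `Gal(K[n]/K)`: there is a UNIQUE `W_n ∈ E(K[n])` with `2^r·W_n = Y_n`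
(`r = #{ℓ∣n}`), and `h·W_n = χ_n(h)·W_n` for every `h ∈ Gal(K[n]/K)`. [cite: GrossLMS1991, §3 (3.5), §4 (4.1), Lemma 4.3]
[cite: SilvermanAEC2009, X.2 Prop. 2.4 (proof)] -/
theorem heegner_existsUnique_reducedGenusPoint [W.IsElliptic] [W.IsGloballyMinimal]
    (hK : IsImaginaryQuadratic K) (hodd : Odd (NumberField.discr K)) (h3 : NumberField.discr K ≠ -3)
    (hH : SatisfiesHeegnerHypothesis (W.conductorNorm ℤ) K) (hsurj : W.HasSurjectiveModNGaloisRep ((2 : ℤ) ^ 1))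
    {n : ℕ} (hn : Squarefree n) (hKoly : ∀ ℓ ∈ n.primeFactors, Zhang2014.IsKolyvaginPrime (W.conductorNorm ℤ) W K 2 ℓ)
    (d : KolyvaginHeegnerData Dt β ι n) {θ : ℕ → ringClassField K ι n}
    (hθ : ∀ ℓ ∈ n.primeFactors, θ ℓ ^ 2 = algebraMap ℚ (ringClassField K ι n) ((-1 : ℚ) ^ (ℓ / 2) * ℓ))
    (G : Finset (ringClassField K ι n ≃ₐ[ℚ] ringClassField K ι n)) (hG : ∀ g, g ∈ G ↔ g ∈ ringClassGal ι n) :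
    (∃! R : (W.baseChange (ringClassField K ι n)).toAffine.Point, ((2 : ℤ) ^ n.primeFactors.card) • R =
      ∑ g ∈ G, (∏ ℓ ∈ n.primeFactors, (if g (θ ℓ) = θ ℓ then (1 : ℤ) else -1)) •
        pointGalHom W (ringClassField K ι n) g d.y) ∧
    ∀ R : (W.baseChange (ringClassField K ι n)).toAffine.Point, ((2 : ℤ) ^ n.primeFactors.card) • R =
      ∑ g ∈ G, (∏ ℓ ∈ n.primeFactors, (if g (θ ℓ) = θ ℓ then (1 : ℤ) else -1)) •
        pointGalHom W (ringClassField K ι n) g d.y →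
      ∀ h ∈ ringClassGal ι n, pointGalHom W (ringClassField K ι n) h R =
        (∏ ℓ ∈ n.primeFactors, (if h (θ ℓ) = θ ℓ then (1 : ℤ) else -1)) • R := by
  have hn0 : n ≠ 0 := hn.ne_zero
  have hD : NumberField.discr K < -4 := discr_lt_neg_four_of_odd hK hodd h3
  have htors := heegner_two_torsion_free (ι := ι) hK hodd hH hsurj hn0
  obtain ⟨R, hR⟩ := heegner_exists_two_pow_card_smul_eq_topGenusComponent hK hD hH hn hKoly d hθ G hG
  refine ⟨⟨R, hR, fun R' hR' ↦ ?_⟩, fun R' hR' h hh ↦ ?_⟩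
  · -- uniqueness: `2^r (R' − R) = 0` in a group without `2`-torsion
    have h0 : ((2 : ℤ) ^ n.primeFactors.card) • (R' - R) = 0 := by rw [smul_sub, hR', hR, sub_self]
    exact sub_eq_zero.mp (eq_zero_of_two_pow_smul_eq_zero
      htors _ _ h0)
  · exact heegner_genusComponent_root_isotypic hK hodd hH hsurj hn0 d hθ G hG (Finset.mem_powerset_self _) hR' hh

/-- **At a depth-2 level the certificate is the `2`-primitivity of the reduced genus point.** Same frame, `4 ∣ a_ℓ` for all
`ℓ ∣ n`, and `W_n` ANY point with `2^r·W_n = Y_n` (it exists and is unique, above): `P(n) ∈ 2E(K[n]) ⟺ W_n ∈ 2E(K[n])`.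
[cite: GrossLMS1991, §3 (3.5), Prop. 3.7 (1), §4 (4.1), Lemma 4.3] [cite: McCallumLMS1991, §5] -/
theorem heegner_exists_two_zsmul_eq_derivedPoint_iff_reducedGenusPoint_of_depth_two [W.IsElliptic] [W.IsGloballyMinimal]
    (hK : IsImaginaryQuadratic K) (hodd : Odd (NumberField.discr K)) (h3 : NumberField.discr K ≠ -3)
    (hH : SatisfiesHeegnerHypothesis (W.conductorNorm ℤ) K) (hsurj : W.HasSurjectiveModNGaloisRep ((2 : ℤ) ^ 1))
    {n : ℕ} (hn : Squarefree n) (hKoly : ∀ ℓ ∈ n.primeFactors, Zhang2014.IsKolyvaginPrime (W.conductorNorm ℤ) W K 2 ℓ)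
    (hfour : ∀ ℓ ∈ n.primeFactors, (4 : ℤ) ∣ W.frobeniusTrace ℓ)
    (d : KolyvaginHeegnerData Dt β ι n) {θ : ℕ → ringClassField K ι n}
    (hθ : ∀ ℓ ∈ n.primeFactors, θ ℓ ^ 2 = algebraMap ℚ (ringClassField K ι n) ((-1 : ℚ) ^ (ℓ / 2) * ℓ))
    (G : Finset (ringClassField K ι n ≃ₐ[ℚ] ringClassField K ι n)) (hG : ∀ g, g ∈ G ↔ g ∈ ringClassGal ι n)
    {Wn : (W.baseChange (ringClassField K ι n)).toAffine.Point}
    (hWn : ((2 : ℤ) ^ n.primeFactors.card) • Wn =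
      ∑ g ∈ G, (∏ ℓ ∈ n.primeFactors, (if g (θ ℓ) = θ ℓ then (1 : ℤ) else -1)) •
        pointGalHom W (ringClassField K ι n) g d.y) :
    (∃ Q : (W.baseChange (ringClassField K ι n)).toAffine.Point, (2 : ℤ) • Q = d.derivedPoint) ↔
      ∃ Q : (W.baseChange (ringClassField K ι n)).toAffine.Point, (2 : ℤ) • Q = Wn := by
  have htors := heegner_two_torsion_free (ι := ι) hK hodd hH hsurj hn.ne_zero
  rw [heegner_exists_two_zsmul_eq_derivedPoint_iff_topGenusComponent_of_depth_two hK hodd h3 hH hsurj hn hKoly hfour d hθ G hG,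
    ← hWn]
  constructor
  · rintro ⟨Q, hQ⟩
    refine ⟨Q, ?_⟩
    -- `2^r (2Q − W_n) = 0`
    have h0 : ((2 : ℤ) ^ n.primeFactors.card) • ((2 : ℤ) • Q - Wn) = 0 := by
      rw [smul_sub, smul_smul, ← pow_succ, hQ, sub_self]
    exact sub_eq_zero.mp (eq_zero_of_two_pow_smul_eq_zero
      htors _ _ h0)
  · rintro ⟨Q, hQ⟩
    exact ⟨Q, by rw [pow_succ, ← smul_smul, hQ]⟩

/-- **The crux's certificate clause at a depth-2 level ⟺ the reduced genus point is not `2`-divisible** (with `T` any enumeration of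
the radical stabiliser, as in `MultiGenusPrimitivityAtTwo`). [cite: GrossLMS1991, §3 (3.5), Prop. 3.7 (1), §4 (4.1), Lemma 4.3] -/
theorem heegner_certificate_iff_reducedGenusPoint_of_depth_two [W.IsElliptic] [W.IsGloballyMinimal]
    (hK : IsImaginaryQuadratic K) (hodd : Odd (NumberField.discr K)) (h3 : NumberField.discr K ≠ -3)
    (hH : SatisfiesHeegnerHypothesis (W.conductorNorm ℤ) K) (hsurj : W.HasSurjectiveModNGaloisRep ((2 : ℤ) ^ 1))
    {n : ℕ} (hn : Squarefree n) (hKoly : ∀ ℓ ∈ n.primeFactors, Zhang2014.IsKolyvaginPrime (W.conductorNorm ℤ) W K 2 ℓ)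
    (hfour : ∀ ℓ ∈ n.primeFactors, (4 : ℤ) ∣ W.frobeniusTrace ℓ)
    (d : KolyvaginHeegnerData Dt β ι n) {θ : ℕ → ringClassField K ι n}
    (hθ : ∀ ℓ ∈ n.primeFactors, θ ℓ ^ 2 = algebraMap ℚ (ringClassField K ι n) ((-1 : ℚ) ^ (ℓ / 2) * ℓ))
    (G : Finset (ringClassField K ι n ≃ₐ[ℚ] ringClassField K ι n)) (hG : ∀ g, g ∈ G ↔ g ∈ ringClassGal ι n)
    (T : Finset (ringClassField K ι n ≃ₐ[ℚ] ringClassField K ι n))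
    (hT : ∀ g, g ∈ T ↔ g ∈ ringClassGal ι n ∧ ∀ ℓ ∈ n.primeFactors, g (θ ℓ) = θ ℓ)
    {Wn : (W.baseChange (ringClassField K ι n)).toAffine.Point}
    (hWn : ((2 : ℤ) ^ n.primeFactors.card) • Wn =
      ∑ g ∈ G, (∏ ℓ ∈ n.primeFactors, (if g (θ ℓ) = θ ℓ then (1 : ℤ) else -1)) •
        pointGalHom W (ringClassField K ι n) g d.y) :
    (¬ ∃ Q : (W.baseChange (ringClassField K ι n)).toAffine.Point, (2 : ℤ) • Q =
        ∑ g ∈ T, pointGalHom W (ringClassField K ι n) g d.y) ↔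
      ¬ ∃ Q : (W.baseChange (ringClassField K ι n)).toAffine.Point, (2 : ℤ) • Q = Wn := by
  have hD : NumberField.discr K < -4 := discr_lt_neg_four_of_odd hK hodd h3
  rw [← heegner_exists_two_zsmul_eq_derivedPoint_iff_multiGenusTrace hK hD hH hn hKoly d hθ T hT,
    heegner_exists_two_zsmul_eq_derivedPoint_iff_reducedGenusPoint_of_depth_two hK hodd h3 hH hsurj hn hKoly hfour d hθ G hG hWn]

/-- **A `2`-th root of the reduced genus point (when it exists) is again `χ_n`-isotypic** — every step of the `2`-divisibility test on
`W_n` stays inside the `χ_n`-lattice `E(K[n])^{χ_n}` (`≅ E^{(n*)}(K)` under the twist isomorphism): if `2Q = W_n` then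
`h·Q = χ_n(h)·Q` for all `h ∈ Gal(K[n]/K)`. [cite: GrossLMS1991, §4, Lemma 4.3] [cite: SilvermanAEC2009, X.2 Prop. 2.4 (proof)] -/
theorem heegner_reducedGenusPoint_half_isotypic [W.IsElliptic] [W.IsGloballyMinimal]
    (hK : IsImaginaryQuadratic K) (hodd : Odd (NumberField.discr K))
    (hH : SatisfiesHeegnerHypothesis (W.conductorNorm ℤ) K) (hsurj : W.HasSurjectiveModNGaloisRep ((2 : ℤ) ^ 1))
    {n : ℕ} (hn : n ≠ 0) (d : KolyvaginHeegnerData Dt β ι n) {θ : ℕ → ringClassField K ι n}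
    (hθ : ∀ ℓ ∈ n.primeFactors, θ ℓ ^ 2 = algebraMap ℚ (ringClassField K ι n) ((-1 : ℚ) ^ (ℓ / 2) * ℓ))
    (G : Finset (ringClassField K ι n ≃ₐ[ℚ] ringClassField K ι n)) (hG : ∀ g, g ∈ G ↔ g ∈ ringClassGal ι n)
    {Wn Q : (W.baseChange (ringClassField K ι n)).toAffine.Point}
    (hWn : ((2 : ℤ) ^ n.primeFactors.card) • Wn =
      ∑ g ∈ G, (∏ ℓ ∈ n.primeFactors, (if g (θ ℓ) = θ ℓ then (1 : ℤ) else -1)) •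
        pointGalHom W (ringClassField K ι n) g d.y)
    (hQ : (2 : ℤ) • Q = Wn) {h : ringClassField K ι n ≃ₐ[ℚ] ringClassField K ι n} (hh : h ∈ ringClassGal ι n) :
    pointGalHom W (ringClassField K ι n) h Q = (∏ ℓ ∈ n.primeFactors, (if h (θ ℓ) = θ ℓ then (1 : ℤ) else -1)) • Q := by
  have hQ' : ((2 : ℤ) ^ (n.primeFactors.card + 1)) • Q =
      ∑ g ∈ G, (∏ ℓ ∈ n.primeFactors, (if g (θ ℓ) = θ ℓ then (1 : ℤ) else -1)) •
        pointGalHom W (ringClassField K ι n) g d.y := by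
    rw [pow_succ, ← smul_smul, hQ, hWn]
  exact heegner_genusComponent_root_isotypic hK hodd hH hsurj hn d hθ G hG (Finset.mem_powerset_self _) hQ' hh

end Heegner

end Summit.BirchSwinnertonDyer.BirchSwinnertonDyer.Theorems.GenusKoly

end
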